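import Summits.BirchSwinnertonDyer.BirchSwinnertonDyer.Theorems.AdditiveBranchIMCGordTwoRankOneHeegnerKolyvaginManinFree
import Summits.BirchSwinnertonDyer.BirchSwinnertonDyer.Theses.AdditiveBranchIMC
import HarnessLib

/-!
# Route `AdditiveBranchIMC` (rung K1), crux `GordTwoRankOne` (item 19358): the Heegner–Kolyvagin road,
# Part 3 — the crux BY NAME with the complementary rows displayed
# (cell `bsd-addord`, second prover lane `bsd-addord-k1-c3x`, gen 0; `--supports` only)

HONEST FRAMING. Two theorems, no definition, no named fact, no `sorry`; nothing is booked; the item stays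
OPEN. `Summit.BirchSwinnertonDyer.BirchSwinnertonDyer.Theses.AdditiveBranchIMC.GordTwoRankOne` follows from
the PUBLISHED binders and the ONE typed input STEP L_add (`hL`, OPEN at an additive prime) of Part 5's
rider-free `cellGordTwo_missingLowerBoundAt_rankOne_of_towerSurj_of_indexLowerBoundAt'` on the
TOWER-SURJECTIVE rows, Li–Liu–Tian 2024 Thm 1.1 (`hLLT`, PUBLISHED; lane A's `gordTwoRankOne_cm_of_liLiuTian`)
on the CM rows, and the crux DISPLAYED on the remaining rows (`hRest`: non-CM pairs whose `p`-adic tower is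
not surjective — reducible `E[p]` (X3♯) and the non-surjective irreducible images (O8) —, lane A's
territory). An honest split, not a closure. The second theorem records the road's residual AT THE LEVEL OF
THE CRUX: STEP L_add on the tower-surjective rows ALONE already gives the crux on those rows, so the crux's
class-level content on X4♯ ∩ surj is exactly one typed predicate shared with route X11b (B9/B10).

References: [JetchevSkinnerWan2017] §7.4.1; [LiLiuTian2024] Thm 1.1; [Miller2011LMS] Def 1.1.
-/

set_option autoImplicit false
set_option linter.dupNamespace false
noncomputable section

open scoped Classical NumberField
open WeierstrassCurve NumberField IsDedekindDomain
  Literature.NumberTheory.EllipticCurves Literature.NumberTheory.EllipticCurves.ModularForms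
  Literature.NumberTheory.EllipticCurves.Rank1Residual
  Literature.NumberTheory.EllipticCurves.Rank1Residual.Typed
  Summit.BirchSwinnertonDyer.Rank1Residual
  Summit.BirchSwinnertonDyer.Rank1Residual.Additive
  Summit.BirchSwinnertonDyer.Rank1Residual.X11b
  Summit.BirchSwinnertonDyer.Rank1Residual.GaloisImage
  Literature.NumberTheory.Automorphic

namespace Summit.BirchSwinnertonDyer.BirchSwinnertonDyer.Theorems.AdditiveBranchIMCGordTwoRankOne.HeegnerKolyvagin

/-! ### §9 The crux BY NAME -/

/-- **The crux `GordTwoRankOne` BY NAME from the road's inputs, with the complementary rows displayed.**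
`Summit.BirchSwinnertonDyer.BirchSwinnertonDyer.Theses.AdditiveBranchIMC.GordTwoRankOne` follows from: the
PUBLISHED binders (`hGZ` Gross–Zagier, `hKo` Kolyvagin, `hKatoT` Kato 14.5 (3) Tamagawa-exact, `hGZK`,
`hmod`/`hnf`/`hmodP` modularity, `hFH` Friedberg–Hoffstein, `hLLT` Li–Liu–Tian 2024 Thm 1.1) and the ONE typed
input STEP L_add (`hL`: `X11b.IndexLowerBoundAt` at every Heegner datum of a tower-surjective rank-one pair
of the cell — OPEN at an additive prime) on the TOWER-SURJECTIVE rows; `hLLT` on the CM rows (lane A's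
`gordTwoRankOne_cm_of_liLiuTian`); and the crux DISPLAYED on the remaining rows (`hRest`: non-CM pairs with a
non-surjective `p`-adic tower — X3♯ and O8 —, lane A's territory). An honest split, not a closure: nothing
is booked; the item stays OPEN. [cite: JetchevSkinnerWan2017, §7.4.1 (pp. 29–31)]
[cite: LiLiuTian2024, Thm. 1.1 (i)] [cite: Miller2011LMS, Def. 1.1] -/
theorem gordTwoRankOne_of_indexLowerBoundAt_of_rest
    -- published inputs (named facts of the tree)
    (hGZ : ∀ (N : ℕ) [NeZero N] (W : WeierstrassCurve ℚ) (K : Type) [Field K] [NumberField K],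
      gross_zagier N W K)
    (hKo : ∀ (N : ℕ) [NeZero N] (W : WeierstrassCurve ℚ) (K : Type) [Field K] [NumberField K],
      kolyvagin N W K)
    (hKatoT : Kato2004.rankZero_padicValNat_sha_add_padicValNat_tamagawa_le_of_additive_potGood_of_imageContainsSL2)
    (hGZK : rank_eq_analyticRank_of_analyticRank_le_one) (hmod : hasEntireLFunction_rat)
    (hnf : exists_isNewformOf) (hmodP : nonempty_modularParametrizationData)
    (hFH : friedbergHoffstein_exists_heegnerField_split_twist_ne_zero)
    (hLLT : LiLiuTian2024.thm11_bsdp_of_cm_rank_one)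
    -- the typed input of the road (STEP L_add), at every Heegner datum
    (hL : ∀ (W : WeierstrassCurve ℚ) [W.IsElliptic] [W.IsGloballyMinimal] (p : ℕ) [Fact p.Prime]
      (N : ℕ) [NeZero N] (K : Type) [Field K] [NumberField K]
      (Dt : ModularParametrizationData W N) (H : HeegnerDatum N (NumberField.discr K)) (ι : K →+* ℂ)
      (P : (W.baseChange K).toAffine.Point),
      W.analyticRank = 1 → N10.CellGordTwo W p → (∀ n : ℕ, W.HasSurjectiveModNGaloisRep (p ^ n : ℕ)) →
      W.conductorNorm ℤ = N → IsImaginaryQuadratic K → SatisfiesHeegnerHypothesis N K →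
      WeierstrassCurve.Affine.Point.map ι.toRatAlgHom P = heegnerPointComplex Dt H →
      Finite (W.baseChange K).sha → IndexLowerBoundAt W p K P)
    -- the remaining rows, displayed
    (hRest : ∀ (W : WeierstrassCurve ℚ) [W.IsElliptic] [W.IsGloballyMinimal] (p : ℕ) [Fact p.Prime],
      W.analyticRank = 1 → N10.CellGordTwo W p → ¬ W.HasCM →
      ¬ (∀ n : ℕ, W.HasSurjectiveModNGaloisRep (p ^ n : ℕ)) → Typed.MissingLowerBoundAt W p) :
    Summit.BirchSwinnertonDyer.BirchSwinnertonDyer.Theses.AdditiveBranchIMC.GordTwoRankOne := by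
  intro W _ _ p _ hr hc2
  by_cases hcm : W.HasCM
  · exact gordTwoRankOne_cm_of_liLiuTian hLLT W p hr hc2 hcm
  by_cases hsurj : ∀ n : ℕ, W.HasSurjectiveModNGaloisRep (p ^ n : ℕ)
  · exact cellGordTwo_missingLowerBoundAt_rankOne_of_towerSurj_of_indexLowerBoundAt' hGZ hKo hKatoT hGZK
      hmod hnf hmodP hFH hL W p hr hc2 hsurj
  · exact hRest W p hr hc2 hcm hsurj

/-- **The road's residual at the level of the crux, tower-surjective rows: the crux restricted to
X4♯ ∩ surj IS "PUBLISHED facts + STEP L_add".** For the record of the planner: on the rows of cell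
(G-ord, `e = 2`) in analytic rank `1` with `ρ̄_{E,p^n}` onto for all `n`, the statement of
`Summit.BirchSwinnertonDyer.BirchSwinnertonDyer.Theses.AdditiveBranchIMC.GordTwoRankOne` follows from the
PUBLISHED binders and STEP L_add alone (Part 5) — no `hRest`, no CM input, no Λ-adic child (19497/19498), no
certificate child (19499). The residual typed input coincides with route X11b's STEP L
(`X11b.IndexLowerBoundAt`, items of B9/B10 at `p ∥ N`), read at `p² ∣ N`.
[cite: JetchevSkinnerWan2017, §7.4.1 (pp. 29–31)] [cite: Miller2011LMS, Def. 1.1] -/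
theorem gordTwoRankOne_towerSurj_rows_of_indexLowerBoundAt
    (hGZ : ∀ (N : ℕ) [NeZero N] (W : WeierstrassCurve ℚ) (K : Type) [Field K] [NumberField K],
      gross_zagier N W K)
    (hKo : ∀ (N : ℕ) [NeZero N] (W : WeierstrassCurve ℚ) (K : Type) [Field K] [NumberField K],
      kolyvagin N W K)
    (hKatoT : Kato2004.rankZero_padicValNat_sha_add_padicValNat_tamagawa_le_of_additive_potGood_of_imageContainsSL2)
    (hGZK : rank_eq_analyticRank_of_analyticRank_le_one) (hmod : hasEntireLFunction_rat)
    (hnf : exists_isNewformOf) (hmodP : nonempty_modularParametrizationData)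
    (hFH : friedbergHoffstein_exists_heegnerField_split_twist_ne_zero)
    (hL : ∀ (W : WeierstrassCurve ℚ) [W.IsElliptic] [W.IsGloballyMinimal] (p : ℕ) [Fact p.Prime]
      (N : ℕ) [NeZero N] (K : Type) [Field K] [NumberField K]
      (Dt : ModularParametrizationData W N) (H : HeegnerDatum N (NumberField.discr K)) (ι : K →+* ℂ)
      (P : (W.baseChange K).toAffine.Point),
      W.analyticRank = 1 → N10.CellGordTwo W p → (∀ n : ℕ, W.HasSurjectiveModNGaloisRep (p ^ n : ℕ)) →
      W.conductorNorm ℤ = N → IsImaginaryQuadratic K → SatisfiesHeegnerHypothesis N K →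
      WeierstrassCurve.Affine.Point.map ι.toRatAlgHom P = heegnerPointComplex Dt H →
      Finite (W.baseChange K).sha → IndexLowerBoundAt W p K P) :
    ∀ (W : WeierstrassCurve ℚ) [W.IsElliptic] [W.IsGloballyMinimal] (p : ℕ) [Fact p.Prime],
      (∀ n : ℕ, W.HasSurjectiveModNGaloisRep (p ^ n : ℕ)) →
      W.analyticRank = 1 → N10.CellGordTwo W p → Typed.MissingLowerBoundAt W p :=
  fun W _ _ p _ hsurj hr hc2 ↦
    cellGordTwo_missingLowerBoundAt_rankOne_of_towerSurj_of_indexLowerBoundAt' hGZ hKo hKatoT hGZK hmod hnf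
      hmodP hFH hL W p hr hc2 hsurj

end Summit.BirchSwinnertonDyer.BirchSwinnertonDyer.Theorems.AdditiveBranchIMCGordTwoRankOne.HeegnerKolyvagin

end
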